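import Summits.NavierStokesRegularity.NavierStokesRegularity.Theorems.SqueezeCycleRecurrentLiouvilleClassLimit
import Summits.NavierStokesRegularity.NavierStokesRegularity.Theorems.SqueezeCycleRecurrentLiouvilleShrinkingOrbit
import Summits.NavierStokesRegularity.NavierStokesRegularity.Theorems.SqueezeCycleRecurrentLiouvilleSelfSimilarRepr
import Summits.NavierStokesRegularity.NavierStokesRegularity.Theorems.SqueezeCycleRecurrentLiouvilleSelfSimilarMildVanishes
import HarnessLib

/-!
# Crux `RecurrentLiouville` (stmt-NavierStokesRegularity-1589), line `Sketch` — Branch A: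
  small scaling hulls are removable in the Albritton–Barker class

`smallHullRemoval` (registered alias `stub_rlSmallHullRemoval`): for every rate constant `C` and every
bound `M < ⊤` there is `δ = δ(C, M) > 0` such that a suitable weak solution `(u, p)` of Navier–Stokes
(`ν = 1`, `f = 0`) on `ℝ³ × ℝ₋` with weak gradient `G`, Albritton–Barker quantity `𝐈(ℝ³ × ℝ₋) ≤ M`
and the Type-I rate `‖u(t,x)‖ ≤ C/√(−t)`, whose WHOLE scaling orbit `{u_{e^σ} : σ ∈ ℝ}`
(`u_c(t,x) = c u(c²t, cx)`) stays `δ`-close to `u` in `L³(Q(0,1))`, is regular at the space–time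
origin.  This is the OPENNESS of the Leray/Tsai rung (backward self-similar Type-I profiles are
trivial: Nečas–Růžička–Šverák 1996, Tsai 1998) inside the crux's own compact class, with "distance
to self-similarity" measured intrinsically by the diameter of the profile's scaling orbit and with no
spatial-decay or local-energy hypothesis; it contains the `λ → 1⁺` end of the Type-I `λ`-DSS
Liouville problem in this class (cf. Chae–Wolf 2017 Thm 1.3, Pineau–Vicol 2026 Thm 1.6, which work
in the `HasTypeIDecay` class).

Proof: contradiction + compactness, composing the four landed stubs of the line —
`stub_rlClassLimit` (A–B Lemma 2.2 + Prop. 2.3: singular class limits with the rate),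
`stub_rlSelfSimilarOfShrinkingOrbit` (shrinking orbit diameters ⇒ a.e. scale-invariant limit),
`stub_rlSelfSimilarRepr` (continuous Type-I ancient mild representative, scale invariant pointwise),
`stub_rlSelfSimilarMildVanishes` (Tsai 1998 Thm 1 at `q = ∞` in the KNSS gauge: it vanishes) — so the
singular limit is a.e. zero on `Q(0,1)`, absurd.

## References

* T.-P. Tsai, Arch. Rational Mech. Anal. 143 (1998), Thm 1. [Tsai1998]
* J. Nečas, M. Růžička, V. Šverák, Acta Math. 176 (1996), Thm 1. [NecasRuzickaSverak1996]
* D. Albritton, T. Barker, J. Math. Fluid Mech. 21 (2019) = arXiv:1811.00502, Lemma 2.2, Prop. 2.3.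
  [AlbrittonBarker2019]
* D. Chae, J. Wolf, Comm. PDE 42 (2017) = arXiv:1610.09464, Thm 1.3. [ChaeWolf2017RemovingDSS]
-/

noncomputable section

-- the sub-problem namespace repeats the summit name (D-0017 layout `Summit.<S>.<P>.Theorems`)
set_option linter.dupNamespace false

namespace Summit.NavierStokesRegularity.NavierStokesRegularity.Theorems

open MeasureTheory Set Function Filter Topology TopologicalSpace Metric
open Literature.Analysis.FluidPDE
open scoped NNReal ENNReal

/-! ## Branch A, proved from S1–S4: small scaling hulls are removable -/

/-- **Small-hull removal (openness of the Leray/Tsai rung in the Albritton–Barker class).**  For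
every rate constant `C` and every bound `M < ⊤` there is `δ > 0` such that a suitable weak solution
on `ℝ³ × ℝ₋` with a weak gradient, `𝐈 ≤ M` and the rate `C`, whose whole scaling orbit stays
`δ`-close to it in `L³(Q(0,1))`, is regular at the space–time origin.  Proof: otherwise pick, for
`δ_k = 1/(k+1)`, an origin-singular member `u_k` of the class with orbit diameter `≤ δ_k`; by S1 a
subsequence converges in every `L³(Q(0,R))` to an origin-singular class profile `w` with the rate; by
S2 `w` is a.e. scale invariant; by S3 it is a.e. a pointwise scale-invariant Type-I ancient mild field
`v`; by S4 `v ≡ 0`; so `w = 0` a.e. on `Q(0,1)`, contradicting `‖w‖_{L^∞(Q(0,1))} = ∞`.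
[cite: Tsai1998, Thm 1; AlbrittonBarker2019, Lemma 2.2, Prop. 2.3] -/
theorem smallHullRemoval (C : ℝ) (M : ℝ≥0∞) (hM : M < ⊤) :
    ∃ δ : ℝ, 0 < δ ∧
      ∀ (u : ℝ → EuclideanSpace ℝ (Fin 3) → EuclideanSpace ℝ (Fin 3))
        (p : ℝ → EuclideanSpace ℝ (Fin 3) → ℝ)
        (G : ℝ → EuclideanSpace ℝ (Fin 3) → EuclideanSpace ℝ (Fin 3) →L[ℝ] EuclideanSpace ℝ (Fin 3)),
        IsSuitableWeakSolutionOn (slab (EuclideanSpace ℝ (Fin 3)) (Iio 0) isOpen_Iio) 1 0 u p →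
        HasWeakSpatialGradientOn (slab (EuclideanSpace ℝ (Fin 3)) (Iio 0) isOpen_Iio) u G →
        typeIBound (Iio (0 : ℝ) ×ˢ univ) u p G ≤ M →
        HasTypeITimeDecay C u →
        (∀ σ : ℝ, eLpNorm (uncurry (nsRescale (Real.exp σ) u) - uncurry u) 3
          (volume.restrict (parabolicCylinder 1 (0 : ℝ × EuclideanSpace ℝ (Fin 3)))) ≤ ENNReal.ofReal δ) →
        ¬ IsBackwardSingularPoint u 0 := by
  by_contra hcon
  push Not at hcon
  have hδk : ∀ k : ℕ, (0 : ℝ) < 1 / ((k : ℝ) + 1) := fun k => by positivity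
  choose u p G hsw hwg hI hdec hdev hsing using fun k : ℕ => hcon _ (hδk k)
  -- S1: a singular class limit with the rate
  obtain ⟨w, q, H, ψ, hψ, hsw', hwg', hI', hdec', hsing', hconv⟩ :=
    stub_rlClassLimit C M hM u p G hsw hwg hI hdec hsing
  -- measurability of (rescaled) class profiles on the balls
  have hmeas : ∀ (k : ℕ) (c : ℝ), 0 < c → ∀ R : ℝ, 0 < R →
      AEStronglyMeasurable (uncurry (nsRescale c (u k)))
        (volume.restrict (parabolicCylinder R (0 : ℝ × EuclideanSpace ℝ (Fin 3)))) := by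
    intro k c hc R _
    rw [nsRescale_eq_zoom]
    exact (zoom_slabProfile (hsw k) (hwg k) hc).2.1.locallyIntegrableOn.aestronglyMeasurable.mono_measure
      (Measure.restrict_mono (parabolicCylinder_origin_subset_slab _) le_rfl)
  have hmeasw : ∀ (c : ℝ), 0 < c → ∀ R : ℝ, 0 < R →
      AEStronglyMeasurable (uncurry (nsRescale c w))
        (volume.restrict (parabolicCylinder R (0 : ℝ × EuclideanSpace ℝ (Fin 3)))) := by
    intro c hc R _
    rw [nsRescale_eq_zoom]
    exact (zoom_slabProfile hsw' hwg' hc).2.1.locallyIntegrableOn.aestronglyMeasurable.mono_measure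
      (Measure.restrict_mono (parabolicCylinder_origin_subset_slab _) le_rfl)
  -- S2: the limit is a.e. scale invariant
  have hδψ : Tendsto (fun j : ℕ => 1 / (((ψ j : ℕ) : ℝ) + 1)) atTop (𝓝 0) :=
    (tendsto_one_div_add_atTop_nhds_zero_nat (𝕜 := ℝ)).comp hψ.tendsto_atTop
  have hss : ∀ σ : ℝ, ∀ᵐ z ∂(volume.restrict (Iio (0 : ℝ) ×ˢ (univ : Set (EuclideanSpace ℝ (Fin 3))))),
      nsRescale (Real.exp σ) w z.1 z.2 = w z.1 z.2 :=
    stub_rlSelfSimilarOfShrinkingOrbit (fun j => u (ψ j)) w (fun j => 1 / (((ψ j : ℕ) : ℝ) + 1)) hδψ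
      (fun j => hmeas (ψ j)) hmeasw hconv (fun j σ => hdev (ψ j) σ)
  -- S3: continuous, pointwise scale-invariant Type-I ancient mild representative
  obtain ⟨v, hv, hvss, hae⟩ := stub_rlSelfSimilarRepr C w q H hsw' hwg' hI' hdec' hss
  -- S4: it vanishes
  have hv0 : ∀ t : ℝ, t < 0 → ∀ x, v t x = 0 := stub_rlSelfSimilarMildVanishes C v hv hvss
  -- hence `w = 0` a.e. on the slab and on `Q(0,1)`: not singular
  have hw0 : ∀ᵐ z ∂(volume.restrict (Iio (0 : ℝ) ×ˢ (univ : Set (EuclideanSpace ℝ (Fin 3))))),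
      uncurry w z = (0 : ℝ × EuclideanSpace ℝ (Fin 3) → EuclideanSpace ℝ (Fin 3)) z := by
    filter_upwards [hae, ae_restrict_mem (measurableSet_Iio.prod MeasurableSet.univ)] with z hz hzm
    rw [hz, Pi.zero_apply]
    exact hv0 z.1 hzm.1 z.2
  have hQ : ∀ᵐ z ∂(volume.restrict (parabolicCylinder 1 (0 : ℝ × EuclideanSpace ℝ (Fin 3)))),
      uncurry w z = (0 : ℝ × EuclideanSpace ℝ (Fin 3) → EuclideanSpace ℝ (Fin 3)) z :=
    ae_restrict_of_ae_restrict_of_subset (parabolicCylinder_origin_subset_slab 1) hw0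
  have h0 : eLpNorm (uncurry w) ∞
      (volume.restrict (parabolicCylinder 1 (0 : ℝ × EuclideanSpace ℝ (Fin 3)))) = 0 := by
    rw [eLpNorm_congr_ae hQ, eLpNorm_zero]
  have htop := hsing' 1 one_pos
  rw [h0] at htop
  exact ENNReal.zero_ne_top htop

/-- **Registered alias** (`ledger skeleton check`, stub `stub_rlSmallHullRemoval` of crux
stmt-NavierStokesRegularity-1589, line Sketch): small scaling hulls are removable in the
Albritton–Barker class, verbatim `smallHullRemoval`. [cite: Tsai1998, Thm 1] -/
theorem stub_rlSmallHullRemoval :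
    ∀ (C : ℝ) (M : ℝ≥0∞), M < ⊤ →
      ∃ δ : ℝ, 0 < δ ∧
        ∀ (u : ℝ → EuclideanSpace ℝ (Fin 3) → EuclideanSpace ℝ (Fin 3))
          (p : ℝ → EuclideanSpace ℝ (Fin 3) → ℝ)
          (G : ℝ → EuclideanSpace ℝ (Fin 3) → EuclideanSpace ℝ (Fin 3) →L[ℝ] EuclideanSpace ℝ (Fin 3)),
          IsSuitableWeakSolutionOn (slab (EuclideanSpace ℝ (Fin 3)) (Iio 0) isOpen_Iio) 1 0 u p →
          HasWeakSpatialGradientOn (slab (EuclideanSpace ℝ (Fin 3)) (Iio 0) isOpen_Iio) u G →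
          typeIBound (Iio (0 : ℝ) ×ˢ univ) u p G ≤ M →
          HasTypeITimeDecay C u →
          (∀ σ : ℝ, eLpNorm (uncurry (nsRescale (Real.exp σ) u) - uncurry u) 3
            (volume.restrict (parabolicCylinder 1 (0 : ℝ × EuclideanSpace ℝ (Fin 3)))) ≤ ENNReal.ofReal δ) →
          ¬ IsBackwardSingularPoint u 0 :=
  fun C M hM => smallHullRemoval C M hM

end Summit.NavierStokesRegularity.NavierStokesRegularity.Theorems

end
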